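import Mathlib
import Literature.Analysis.FluidPDE.LerayHopf
import HarnessLib

/-!
# An `Lᵖ`-continuous family on a compact interval has a jointly measurable version

Analysis/FluidPDE proof file (theorems only). The class `C([a,b]; Lᵖ(X))` of the tree is the pointwise
predicate `Literature.Analysis.FluidPDE.ContinuousInLpOn (Icc a b) p f` on a FUNCTION `f : ℝ → X → F`: each
slice is in `Lᵖ` and `t ↦ ‖f t − f t₀‖_{Lᵖ}` is continuous on `[a,b]`. Such an `f` need not be jointly
measurable on `[a,b] × X` (its slices are only determined almost everywhere), whereas existence theorems
(e.g. the tree's Hopf theorem on `𝕋³`, `hopf_existence_torus`, for the force) ask for a space–time measurable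
datum. This file supplies the classical bridge (Robinson–Rodrigo–Sadowski 2016, §1.9.1, p. 37: «we can
identify `Lᵖ(0,T;Lᵖ(Ω))` with `Lᵖ(Ω × (0,T))` for `1 ≤ p < ∞`» — a strongly measurable `Lᵖ`-valued map has a
jointly measurable representative; here for the continuous maps the claim skeletons use):

* `ContinuousInLpOn.exists_stronglyMeasurable_version` — for `1 ≤ p < ∞` and `f ∈ C([a,b];Lᵖ(X;F))` there is
  `g : ℝ → X → F` with `uncurry g` strongly measurable and `g t = f t` a.e. for every `t ∈ [a,b]`.

Proof (elementary, self-contained): `f` is uniformly `Lᵖ`-continuous on the compact `[a,b]` (Lebesgue number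
lemma); sampling `f` on the grids `⌊tn⌋/n` (clamped to `[a,b]`) through strongly measurable representatives of
the countably many sampled slices gives jointly measurable fields `fₙ` with `sup_t ‖fₙ t − f t‖_{Lᵖ} → 0`;
along a subsequence with summable errors `∫ Σⱼ ‖f_{nⱼ} t − f t‖^p < ∞`, so `f_{nⱼ} t → f t` a.e. for every
`t`, and `g := limUnder` of that subsequence is strongly measurable (Mathlib
`StronglyMeasurable.limUnder`) and is a version of `f`.
TODO(general form): the same for strongly measurable `u : [0,T] → Lᵖ(X)` (RRS Def. 1.22), not needed here.

## References
* J. C. Robinson, J. L. Rodrigo, W. Sadowski, *The three-dimensional Navier–Stokes equations*, CUP 2016,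
  §1.9.1 p. 37 (Bochner spaces; identification of `Lᵖ(0,T;Lᵖ)` with `Lᵖ` of the product).
  [RobinsonRodrigoSadowskiCUP2016]
-/

noncomputable section

open MeasureTheory Set Filter Function Topology
open scoped ENNReal NNReal Topology

namespace Literature.Analysis.FluidPDE

variable {X : Type*} [MeasureSpace X]
variable {F : Type*} [NormedAddCommGroup F] [SecondCountableTopology F] [MeasurableSpace F] [BorelSpace F]
  [CompleteSpace F]

/-! ### Uniform `Lᵖ`-continuity on a compact interval -/

omit [SecondCountableTopology F] [MeasurableSpace F] [BorelSpace F] [CompleteSpace F] in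
/-- A `C([a,b];Lᵖ)` family is uniformly `Lᵖ`-continuous on `[a,b]` (Lebesgue number lemma for the cover
of `[a,b]` by the balls on which `‖f t − f s‖_{Lᵖ} < ε/2`). [folklore] -/
private theorem exists_delta_of_continuousInLpOn {a b : ℝ} {p : ℝ≥0∞} (hp : 1 ≤ p) {f : ℝ → X → F}
    (hf : ContinuousInLpOn (Icc a b) p f) {ε : ℝ≥0∞} (hε : 0 < ε) :
    ∃ δ > 0, ∀ s ∈ Icc a b, ∀ t ∈ Icc a b, dist s t < δ →
      eLpNorm (f s - f t) p volume < ε := by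
  set S : Set ℝ := Icc a b with hS
  have hε2 : 0 < ε / 2 := ENNReal.half_pos hε.ne'
  -- radii from continuity within `S`
  have hrad : ∀ i : S, ∃ r > 0, ∀ t ∈ S, dist t i < r → eLpNorm (f t - f i) p volume < ε / 2 := by
    intro i
    have hev : {t | eLpNorm (f t - f i) p volume < ε / 2} ∈ 𝓝[S] (i : ℝ) :=
      (hf.2 i i.2) (Iio_mem_nhds hε2)
    obtain ⟨r, hr, h⟩ := Metric.mem_nhdsWithin_iff.1 hev
    exact ⟨r, hr, fun t ht hti => h ⟨hti, ht⟩⟩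
  choose r hr hrad using hrad
  obtain ⟨δ, hδ, hleb⟩ := lebesgue_number_lemma_of_metric (ι := S) (c := fun i => Metric.ball (i : ℝ) (r i))
    isCompact_Icc (fun i => Metric.isOpen_ball) (fun s hs => mem_iUnion.2 ⟨⟨s, hs⟩, Metric.mem_ball_self (hr _)⟩)
  refine ⟨δ, hδ, fun s hs t ht hst => ?_⟩
  obtain ⟨i, hi⟩ := hleb s hs
  have hsi : dist s i < r i := hi (Metric.mem_ball_self hδ)
  have hti : dist t i < r i := hi (by rw [Metric.mem_ball, dist_comm]; exact hst)
  have h1 := hrad i s hs hsi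
  have h2 := hrad i t ht hti
  have hmeas : ∀ u ∈ S, AEStronglyMeasurable (f u) volume := fun u hu => (hf.1 u hu).1
  calc eLpNorm (f s - f t) p volume
      = eLpNorm ((f s - f i) + (f i - f t)) p volume := by rw [sub_add_sub_cancel]
    _ ≤ eLpNorm (f s - f i) p volume + eLpNorm (f i - f t) p volume :=
        eLpNorm_add_le ((hmeas s hs).sub (hmeas i i.2)) ((hmeas i i.2).sub (hmeas t ht)) hp
    _ < ε / 2 + ε / 2 := by
        rw [eLpNorm_sub_comm (f i) (f t)]
        exact ENNReal.add_lt_add h1 h2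
    _ = ε := ENNReal.add_halves ε

/-! ### The grid -/

omit [SecondCountableTopology F] [MeasurableSpace F] [BorelSpace F] [CompleteSpace F] in
/-- Clamped points lie in `[a,b]`. [folklore] -/
private theorem clampIcc_mem {a b : ℝ} (hab : a ≤ b) (q : ℝ) : max a (min b q) ∈ Icc a b :=
  ⟨le_max_left _ _, max_le hab (min_le_left _ _)⟩

omit [SecondCountableTopology F] [MeasurableSpace F] [BorelSpace F] [CompleteSpace F] in
/-- The clamped grid point `max a (min b (⌊tn⌋/n))` is within `2/n` of `t ∈ [a,b]`. [folklore] -/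
private theorem dist_clampIcc_floor_lt {a b : ℝ} {n : ℕ} (hn : 0 < n) {t : ℝ} (ht : t ∈ Icc a b) :
    dist (max a (min b (((⌊t * (n : ℝ)⌋ : ℤ) : ℝ) / n))) t < 1 / n + 1 / n := by
  have hn' : (0 : ℝ) < n := by exact_mod_cast hn
  set q : ℝ := ((⌊t * (n : ℝ)⌋ : ℤ) : ℝ) / n with hq
  have hq1 : q ≤ t := by
    rw [hq, div_le_iff₀ hn']
    exact Int.floor_le _
  have hq2 : t < q + 1 / n := by
    have h := Int.lt_floor_add_one (t * n)
    rw [hq, ← add_div, lt_div_iff₀ hn']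
    exact h
  rw [min_eq_right (hq1.trans ht.2), Real.dist_eq, abs_sub_lt_iff]
  constructor
  · have : max a q ≤ t := max_le ht.1 hq1
    have h0 : (0 : ℝ) < 1 / n := by positivity
    linarith
  · have : q ≤ max a q := le_max_right _ _
    have h0 : (0 : ℝ) < 1 / n := by positivity
    linarith

/-! ### The theorem -/

/-- **A `C([a,b];Lᵖ)` family has a jointly measurable version** (`1 ≤ p < ∞`): there is `g : ℝ → X → F` with
`uncurry g` strongly measurable and `g t = f t` almost everywhere for every `t ∈ [a,b]` — the continuous case
of the identification `Lᵖ(0,T;Lᵖ(Ω)) = Lᵖ(Ω × (0,T))` (Robinson–Rodrigo–Sadowski 2016 §1.9.1 p. 37).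
[cite: RobinsonRodrigoSadowskiCUP2016, §1.9.1 p. 37] -/
theorem ContinuousInLpOn.exists_stronglyMeasurable_version {a b : ℝ} {p : ℝ≥0∞} (hp : 1 ≤ p)
    (hp' : p ≠ ∞) {f : ℝ → X → F} (hf : ContinuousInLpOn (Icc a b) p f) :
    ∃ g : ℝ → X → F, StronglyMeasurable (uncurry g) ∧ ∀ t ∈ Icc a b, g t =ᵐ[volume] f t := by
  classical
  rcases lt_or_ge b a with hba | hab
  · exact ⟨fun _ _ => 0, stronglyMeasurable_const, fun t ht => absurd ht (by rw [Icc_eq_empty_of_lt hba]; exact notMem_empty t)⟩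
  set S : Set ℝ := Icc a b with hS
  have hp0 : p ≠ 0 := (lt_of_lt_of_le zero_lt_one hp).ne'
  have hr0 : 0 < p.toReal := ENNReal.toReal_pos hp0 hp'
  have hr1 : 1 ≤ p.toReal := by
    have := ENNReal.toReal_mono hp' hp
    simpa using this
  -- strongly measurable representatives of the slices
  have hslice : ∀ q : ℝ, ∃ G : X → F, StronglyMeasurable G ∧ (q ∈ S → G =ᵐ[volume] f q) := by
    intro q
    by_cases hq : q ∈ S
    · exact ⟨(hf.1 q hq).1.mk (f q), (hf.1 q hq).1.stronglyMeasurable_mk,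
        fun _ => ((hf.1 q hq).1.ae_eq_mk).symm⟩
    · exact ⟨fun _ => 0, stronglyMeasurable_const, fun h => absurd h hq⟩
  choose G hGm hGf using hslice
  -- the sampled fields
  -- the grid projections `πₙ t = max a (min b (⌊tn⌋/n)) ∈ [a,b]`
  set π : ℕ → ℝ → ℝ := fun n t => max a (min b (((⌊t * (n : ℝ)⌋ : ℤ) : ℝ) / n)) with hπ
  have hπmem : ∀ n t, π n t ∈ S := fun n t => clampIcc_mem hab _
  set fs : ℕ → ℝ → X → F := fun n t x => G (π n t) x with hfs
  have hfs_meas : ∀ n : ℕ, StronglyMeasurable (uncurry (fs n)) := by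
    intro n
    have h1 : Measurable (fun z : X × ℤ => G (max a (min b ((z.2 : ℝ) / n))) z.1) :=
      measurable_from_prod_countable_left (fun k => (hGm (max a (min b ((k : ℝ) / n)))).measurable)
    have h2 : Measurable (fun z : ℝ × X => (z.2, ⌊z.1 * (n : ℝ)⌋)) :=
      measurable_snd.prodMk (Int.measurable_floor.comp (measurable_fst.mul_const _))
    have h3 : uncurry (fs n) =
        (fun z : X × ℤ => G (max a (min b ((z.2 : ℝ) / n))) z.1) ∘ fun z : ℝ × X => (z.2, ⌊z.1 * (n : ℝ)⌋) := by
      funext z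
      rfl
    rw [h3]
    exact (h1.comp h2).stronglyMeasurable
  -- the rates: `‖f (πₙ t) − f t‖_{Lᵖ} ≤ 2⁻ʲ` uniformly in `t`, for `n = N j`
  have hrate : ∀ j : ℕ, ∃ n : ℕ, 0 < n ∧ ∀ t ∈ S,
      eLpNorm (f (π n t) - f t) p volume ≤ (2⁻¹ : ℝ≥0∞) ^ j := by
    intro j
    have hεj : (0 : ℝ≥0∞) < (2⁻¹ : ℝ≥0∞) ^ j := ENNReal.pow_pos (by norm_num) j
    obtain ⟨δ, hδ, hcont⟩ := exists_delta_of_continuousInLpOn hp hf hεj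
    obtain ⟨n, hn⟩ := exists_nat_one_div_lt (half_pos hδ)
    refine ⟨n + 1, (Nat.succ_pos n : 0 < n + 1), fun t ht =>
      le_of_lt (hcont (π (n + 1) t) (hπmem _ _) t ht ?_)⟩
    have h := dist_clampIcc_floor_lt (a := a) (b := b) (Nat.succ_pos n : 0 < n + 1) ht
    push_cast at h ⊢
    simp only [hπ]
    push_cast
    linarith
  choose N hNpos hN using hrate
  -- the version
  set g : ℝ → X → F := fun t x => limUnder atTop (fun j => fs (N j) t x) with hg
  have hg_meas : StronglyMeasurable (uncurry g) := by
    have := StronglyMeasurable.limUnder (l := (atTop : Filter ℕ)) (f := fun j => uncurry (fs (N j)))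
      (fun j => hfs_meas (N j))
    exact this
  refine ⟨g, hg_meas, fun t ht => ?_⟩
  -- a.e. convergence of the subsequence at a fixed time
  set h : ℕ → X → F := fun j x => fs (N j) t x - f t x with hh
  have hft : AEStronglyMeasurable (f t) volume := (hf.1 t ht).1
  have hh_ae : ∀ j, h j =ᵐ[volume] fun x => f (π (N j) t) x - f t x := by
    intro j
    have := hGf (π (N j) t) (hπmem _ _)
    filter_upwards [this] with x hx
    simp only [hh, hfs, hx]
  have hh_norm : ∀ j, eLpNorm (h j) p volume ≤ (2⁻¹ : ℝ≥0∞) ^ j := fun j => by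
    rw [eLpNorm_congr_ae (hh_ae j)]
    exact hN j t ht
  have hh_meas : ∀ j, AEStronglyMeasurable (h j) volume := fun j =>
    ((hGm _).aestronglyMeasurable).sub hft
  -- `∫ Σⱼ ‖hⱼ‖^r ≤ Σⱼ 2^{-j r} < ∞`
  set A : ℕ → X → ℝ≥0∞ := fun j x => ‖h j x‖ₑ ^ p.toReal with hA
  have hA_meas : ∀ j, AEMeasurable (A j) volume := fun j =>
    (hh_meas j).enorm.pow_const _
  have hA_int : ∀ j, ∫⁻ x, A j x ≤ ((2⁻¹ : ℝ≥0∞) ^ p.toReal) ^ j := by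
    intro j
    have h1 : ∫⁻ x, A j x = eLpNorm (h j) p volume ^ p.toReal := by
      rw [hA, eLpNorm_eq_eLpNorm' hp0 hp']
      exact lintegral_rpow_enorm_eq_rpow_eLpNorm' hr0
    have hswap : ((2⁻¹ : ℝ≥0∞) ^ j) ^ p.toReal = ((2⁻¹ : ℝ≥0∞) ^ p.toReal) ^ j := by
      rw [← ENNReal.rpow_natCast ((2⁻¹ : ℝ≥0∞) ^ p.toReal) j, ← ENNReal.rpow_mul,
        ← ENNReal.rpow_natCast (2⁻¹ : ℝ≥0∞) j, ← ENNReal.rpow_mul, mul_comm]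
    rw [h1, ← hswap]
    exact ENNReal.rpow_le_rpow (hh_norm j) hr0.le
  have hq1 : (2⁻¹ : ℝ≥0∞) ^ p.toReal < 1 :=
    ENNReal.rpow_lt_one (by norm_num : (2⁻¹ : ℝ≥0∞) < 1) hr0
  have htsum : ∫⁻ x, ∑' j, A j x ≠ ∞ := by
    rw [lintegral_tsum hA_meas]
    refine ne_top_of_le_ne_top ?_ (ENNReal.tsum_le_tsum hA_int)
    rw [ENNReal.tsum_geometric]
    exact ENNReal.inv_ne_top.2 (tsub_pos_of_lt hq1).ne'
  have hae_fin : ∀ᵐ x ∂volume, ∑' j, A j x < ∞ :=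
    ae_lt_top' (AEMeasurable.tsum hA_meas) htsum
  have hconv : ∀ᵐ x ∂volume, Tendsto (fun j => fs (N j) t x) atTop (𝓝 (f t x)) := by
    filter_upwards [hae_fin] with x hx
    have h0 : Tendsto (fun j => A j x) atTop (𝓝 0) := ENNReal.tendsto_atTop_zero_of_tsum_ne_top hx.ne
    -- undo the power
    have h1 : Tendsto (fun j => ‖h j x‖ₑ) atTop (𝓝 0) := by
      have hc : Tendsto (fun j => (A j x) ^ (1 / p.toReal)) atTop (𝓝 ((0 : ℝ≥0∞) ^ (1 / p.toReal))) :=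
        (ENNReal.continuous_rpow_const.tendsto 0).comp h0
      rw [ENNReal.zero_rpow_of_pos (by positivity)] at hc
      refine hc.congr fun j => ?_
      rw [hA, ← ENNReal.rpow_mul, mul_one_div_cancel hr0.ne', ENNReal.rpow_one]
    rw [tendsto_iff_edist_tendsto_0]
    refine h1.congr fun j => ?_
    rw [edist_eq_enorm_sub]
  -- the version agrees with `f t` a.e.
  filter_upwards [hconv] with x hx
  exact hx.limUnder_eq

end Literature.Analysis.FluidPDE
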